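import Literature.MathematicalPhysics.QuantumLattice.ApproximateEigenvectorLemmas

/-!
# Telescope rigidity, part 1: the abstract coarse-graining inequality for vectors

Route `DeformationLadder`, crux `LowEnergyRigidity` (item stmt-HubbardSuperconductivity-1892), line
`Sketch` (poincare-telescope). Support file: the purely linear-algebraic heart of the implication
"scale-wise Josephson inequality (`JosephsonInequalityAt`, the telescope's open input 1) ⟹
pair-momentum rigidity at the point (the body of `TwistGap.TgPairMomentumRigidity` at fixed
`(U, δ)`)".

For a finite family of vectors `u_x ∈ ℂⁿ` (the local pairs `P_x φ`), a map `π : X → B` onto `N`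
cells (the vectors `v_b = Σ_{π x = b} u_x` are the cell pair fields `Δ_b φ`, `V = Σ_x u_x = Δ_d φ`),
phases `e_x` and cell phases `c_b` with `|c_b| ≤ 1`, `Σ_b c_b = 0` and `|e_x − c_{π x}| ≤ η`:

`‖Σ_x e_x u_x‖² ≤ 2·N·(Σ_b ‖v_b‖² − ‖V‖²/N) + 2·η²·|X|·Σ_x ‖u_x‖²`

(`rig_eucNorm_sq_sum_smul_le`): split `e_x = c_{π x} + (e_x − c_{π x})`; the first part is
`Σ_b c_b v_b = Σ_b c_b (v_b − V/N)` (the phases sum to zero), bounded by Cauchy–Schwarz and the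
variance identity `Σ_b ‖v_b − V/N‖² = Σ_b ‖v_b‖² − ‖V‖²/N` (`rig_variance_identity`); the second by
the triangle inequality and Cauchy–Schwarz. Elementary finite-dimensional linear algebra; no
definitions are introduced. [folklore]
-/

noncomputable section

namespace Summit.HubbardSuperconductivity.HubbardSuperconductivity.Theorems.LowEnergyRigidity.Telescope

set_option linter.dupNamespace false -- summit = problem name (single-conjunct summit), D-0017

open Matrix Complex Finset Literature.MathematicalPhysics.QuantumLattice
open scoped ComplexConjugate ComplexOrder

variable {n : Type*} [Fintype n]

/-! ### Euclidean-norm bookkeeping -/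

/-- `b⋆·a = conj (a⋆·b)`. [folklore] -/
theorem rig_star_dotProduct_comm (a b : n → ℂ) : star b ⬝ᵥ a = conj (star a ⬝ᵥ b) := by
  simp only [dotProduct, map_sum, map_mul, Pi.star_apply, Complex.star_def, Complex.conj_conj]
  exact Finset.sum_congr rfl fun i _ => mul_comm _ _

/-- `‖a − b‖₂² = ‖a‖₂² + ‖b‖₂² − 2 Re (a⋆·b)`. [folklore] -/
theorem rig_eucNorm_sub_sq (a b : n → ℂ) :
    eucNorm (a - b) ^ 2 = eucNorm a ^ 2 + eucNorm b ^ 2 - 2 * (star a ⬝ᵥ b).re := by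
  rw [eucNorm_sq, eucNorm_sq, eucNorm_sq, star_sub, sub_dotProduct, dotProduct_sub, dotProduct_sub,
    rig_star_dotProduct_comm a b]
  simp only [Complex.sub_re, Complex.conj_re]
  ring

/-- `‖a + b‖₂² ≤ 2‖a‖₂² + 2‖b‖₂²`. [folklore] -/
theorem rig_eucNorm_add_sq_le (a b : n → ℂ) :
    eucNorm (a + b) ^ 2 ≤ 2 * eucNorm a ^ 2 + 2 * eucNorm b ^ 2 := by
  have h := eucNorm_add_le a b
  have h0 := eucNorm_nonneg (a + b)
  nlinarith [sq_nonneg (eucNorm a - eucNorm b), eucNorm_nonneg a, eucNorm_nonneg b]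

/-- The Euclidean norm is subadditive over finite sums. [folklore] -/
theorem rig_eucNorm_sum_le {ι : Type*} (s : Finset ι) (v : ι → n → ℂ) :
    eucNorm (∑ i ∈ s, v i) ≤ ∑ i ∈ s, eucNorm (v i) := by
  classical
  induction s using Finset.induction_on with
  | empty => simp
  | insert a s ha ih =>
    rw [Finset.sum_insert ha, Finset.sum_insert ha]
    exact (eucNorm_add_le _ _).trans (by linarith)

/-- `‖Σ_i c_i v_i‖₂ ≤ Σ_i ‖c_i‖ ‖v_i‖₂`. [folklore] -/
theorem rig_eucNorm_sum_smul_le {ι : Type*} (s : Finset ι) (c : ι → ℂ) (v : ι → n → ℂ) :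
    eucNorm (∑ i ∈ s, c i • v i) ≤ ∑ i ∈ s, ‖c i‖ * eucNorm (v i) := by
  refine (rig_eucNorm_sum_le s _).trans (le_of_eq ?_)
  exact Finset.sum_congr rfl fun i _ => eucNorm_smul _ _

/-! ### The variance identity on `N` cells -/

/-- **Variance identity**: for vectors `v_b`, `b ∈ B`, `|B| = N > 0`, `V = Σ_b v_b`,
`Σ_b ‖v_b − V/N‖₂² = Σ_b ‖v_b‖₂² − ‖V‖₂²/N`. [folklore] -/
theorem rig_variance_identity {B : Type*} [Fintype B] [Nonempty B] (v : B → n → ℂ) :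
    ∑ b, eucNorm (v b - ((Fintype.card B : ℂ))⁻¹ • ∑ b', v b') ^ 2 =
      ∑ b, eucNorm (v b) ^ 2 - eucNorm (∑ b', v b') ^ 2 / (Fintype.card B : ℝ) := by
  set V := ∑ b', v b' with hV
  set N : ℝ := (Fintype.card B : ℝ) with hN
  have hNpos : 0 < N := by rw [hN]; exact_mod_cast Fintype.card_pos
  have hNC : ((Fintype.card B : ℂ))⁻¹ = ((N⁻¹ : ℝ) : ℂ) := by rw [hN]; push_cast; rfl
  simp_rw [hNC, rig_eucNorm_sub_sq]
  have hsm : ∀ b, (star (v b) ⬝ᵥ ((N⁻¹ : ℝ) : ℂ) • V).re = N⁻¹ * (star (v b) ⬝ᵥ V).re := by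
    intro b
    rw [dotProduct_smul, smul_eq_mul, Complex.re_ofReal_mul]
  have hnV : eucNorm (((N⁻¹ : ℝ) : ℂ) • V) ^ 2 = N⁻¹ ^ 2 * eucNorm V ^ 2 := by
    rw [eucNorm_smul, Complex.norm_real, Real.norm_eq_abs, abs_of_pos (inv_pos.mpr hNpos)]
    ring
  simp_rw [hsm, hnV]
  rw [Finset.sum_sub_distrib, Finset.sum_add_distrib, Finset.sum_const, Finset.card_univ,
    nsmul_eq_mul, ← Finset.mul_sum, ← Finset.mul_sum, ← Complex.re_sum, ← sum_dotProduct,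
    ← star_sum]
  rw [show (∑ i, v i) = V from rfl, ← hN]
  have hVV : (star V ⬝ᵥ V).re = eucNorm V ^ 2 := (eucNorm_sq V).symm
  rw [hVV]
  field_simp
  ring

/-! ### The coarse-graining inequality -/

/-- **Coarse-graining inequality.** Vectors `u_x` (`x ∈ X`), a cell map `π : X → B` onto
`N = |B| > 0` cells with cell sums `v_b = Σ_{π x = b} u_x` and total `V = Σ_x u_x`, phases `e_x`
and cell phases `c_b` with `‖c_b‖ ≤ 1`, `Σ_b c_b = 0`, `‖e_x − c_{π x}‖ ≤ η` (`η ≥ 0`). Then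
`‖Σ_x e_x u_x‖₂² ≤ 2 N (Σ_b ‖v_b‖₂² − ‖V‖₂²/N) + 2 η² |X| Σ_x ‖u_x‖₂²`. [folklore] -/
theorem rig_eucNorm_sq_sum_smul_le {X B : Type*} [Fintype X] [Fintype B] [Nonempty B]
    [DecidableEq B] (u : X → n → ℂ) (π : X → B) (e : X → ℂ) (c : B → ℂ) {η : ℝ}
    (hc1 : ∀ b, ‖c b‖ ≤ 1) (hc0 : ∑ b, c b = 0) (hec : ∀ x, ‖e x - c (π x)‖ ≤ η) :
    eucNorm (∑ x, e x • u x) ^ 2 ≤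
      2 * (Fintype.card B : ℝ) *
          (∑ b, eucNorm (∑ x ∈ Finset.univ.filter (fun x => π x = b), u x) ^ 2 -
            eucNorm (∑ x, u x) ^ 2 / (Fintype.card B : ℝ)) +
        2 * η ^ 2 * (Fintype.card X : ℝ) * ∑ x, eucNorm (u x) ^ 2 := by
  classical
  set v : B → n → ℂ := fun b => ∑ x ∈ Finset.univ.filter (fun x => π x = b), u x with hv
  set V := ∑ x, u x with hV
  have hNpos : 0 < (Fintype.card B : ℝ) := by exact_mod_cast Fintype.card_pos
  -- `V = Σ_b v_b`
  have hVsum : ∑ b, v b = V := by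
    rw [hV, hv]
    exact Finset.sum_fiberwise Finset.univ π u
  -- the split `e_x = c_{π x} + (e_x − c_{π x})`
  set Avec := ∑ b, c b • v b with hA
  set Bvec := ∑ x, (e x - c (π x)) • u x with hB
  have hsplit : ∑ x, e x • u x = Avec + Bvec := by
    have h1 : Avec = ∑ x, c (π x) • u x := by
      rw [hA, hv]
      simp_rw [Finset.smul_sum]
      rw [← Finset.sum_fiberwise Finset.univ π (fun x => c (π x) • u x)]
      refine Finset.sum_congr rfl fun b _ => Finset.sum_congr rfl fun x hx => ?_
      rw [(Finset.mem_filter.mp hx).2]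
    rw [h1, hB, ← Finset.sum_add_distrib]
    refine Finset.sum_congr rfl fun x _ => ?_
    rw [← add_smul, add_sub_cancel]
  -- the A-part: `Σ_b c_b v_b = Σ_b c_b (v_b − V/N)`
  have hA' : Avec = ∑ b, c b • (v b - ((Fintype.card B : ℂ))⁻¹ • ∑ b', v b') := by
    rw [hA]
    simp_rw [smul_sub, Finset.sum_sub_distrib]
    rw [← Finset.sum_smul, hc0, zero_smul, sub_zero]
  have hAle : eucNorm Avec ^ 2 ≤
      (Fintype.card B : ℝ) * (∑ b, eucNorm (v b) ^ 2 - eucNorm V ^ 2 / (Fintype.card B : ℝ)) := by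
    have h1 : eucNorm Avec ≤ ∑ b, eucNorm (v b - ((Fintype.card B : ℂ))⁻¹ • V) := by
      rw [hA', hVsum]
      refine (rig_eucNorm_sum_smul_le _ _ _).trans (Finset.sum_le_sum fun b _ => ?_)
      exact mul_le_of_le_one_left (eucNorm_nonneg _) (hc1 b)
    have h2 := pow_le_pow_left₀ (eucNorm_nonneg _) h1 2
    have h3 := sq_sum_le_card_mul_sum_sq (s := Finset.univ)
      (f := fun b => eucNorm (v b - ((Fintype.card B : ℂ))⁻¹ • ∑ b', v b'))
    rw [Finset.card_univ, rig_variance_identity v, hVsum] at h3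
    exact h2.trans h3
  -- the B-part
  have hBle : eucNorm Bvec ^ 2 ≤ η ^ 2 * (Fintype.card X : ℝ) * ∑ x, eucNorm (u x) ^ 2 := by
    have h1 : eucNorm Bvec ≤ η * ∑ x, eucNorm (u x) := by
      rw [hB, Finset.mul_sum]
      refine (rig_eucNorm_sum_smul_le _ _ _).trans (Finset.sum_le_sum fun x _ => ?_)
      exact mul_le_mul_of_nonneg_right (hec x) (eucNorm_nonneg _)
    have h0 : 0 ≤ ∑ x, eucNorm (u x) := Finset.sum_nonneg fun x _ => eucNorm_nonneg _
    have h2 : eucNorm Bvec ^ 2 ≤ (η * ∑ x, eucNorm (u x)) ^ 2 := pow_le_pow_left₀ (eucNorm_nonneg _) h1 2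
    have h3 := sq_sum_le_card_mul_sum_sq (s := Finset.univ) (f := fun x => eucNorm (u x))
    rw [Finset.card_univ] at h3
    calc eucNorm Bvec ^ 2 ≤ η ^ 2 * (∑ x, eucNorm (u x)) ^ 2 := by rw [← mul_pow]; exact h2
      _ ≤ η ^ 2 * ((Fintype.card X : ℝ) * ∑ x, eucNorm (u x) ^ 2) :=
          mul_le_mul_of_nonneg_left h3 (sq_nonneg _)
      _ = η ^ 2 * (Fintype.card X : ℝ) * ∑ x, eucNorm (u x) ^ 2 := by ring
  rw [hsplit]
  have := rig_eucNorm_add_sq_le Avec Bvec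
  nlinarith [hAle, hBle]

/-- **Coarse-graining inequality, registered form** (all binders after the colon; small types): the
statement of `rig_eucNorm_sq_sum_smul_le` for `n X B : Type`. [folklore] -/
theorem rig_coarseGraining : ∀ (n X B : Type) [Fintype n] [Fintype X] [Fintype B] [Nonempty B] [DecidableEq B] (u : X → n → ℂ) (π : X → B) (e : X → ℂ) (c : B → ℂ) (η : ℝ), (∀ b, ‖c b‖ ≤ 1) → ∑ b, c b = 0 → (∀ x, ‖e x - c (π x)‖ ≤ η) → eucNorm (∑ x, e x • u x) ^ 2 ≤ 2 * (Fintype.card B : ℝ) * (∑ b, eucNorm (∑ x ∈ Finset.univ.filter (fun x => π x = b), u x) ^ 2 - eucNorm (∑ x, u x) ^ 2 / (Fintype.card B : ℝ)) + 2 * η ^ 2 * (Fintype.card X : ℝ) * ∑ x, eucNorm (u x) ^ 2 :=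
  fun _ _ _ _ _ _ _ _ u π e c _ hc1 hc0 hec => rig_eucNorm_sq_sum_smul_le u π e c hc1 hc0 hec

end Summit.HubbardSuperconductivity.HubbardSuperconductivity.Theorems.LowEnergyRigidity.Telescope
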